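import Summits.CriticalPhenomena.CardyFormulaZ2.Theorems.CardyBoundaryCoulombGasBoundaryDefectGaussianRS17RainbowOfConfig
import Summits.CriticalPhenomena.CardyFormulaZ2.Theorems.CardyBoundaryCoulombGasBoundaryDefectGaussianRS17DictionaryOfPart1
import Literature.Probability.Percolation.FKLoopWindingCells

/-!
# Stub `s17_heightsExist` of line `rainbow-monomials-in-excursion-kernels` — Part 2:
# compatibility of the arrows at the starts; the cycle condition of `w = sgn s - sgn (bit h₀)`
# (crux `BoundaryDefectGaussianR`, stmt-CriticalPhenomena-14132; insertion dictionary D2, T5c)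

Setting of T5c (`s17_heightsExist`): `M = ι.model V` the jump collar of an ADMISSIBLE leg insertion
with FLAT insertion points (radius `sinkLegs + 4`) and radius-`3` CHARTS; a valid `h₀`; a RAINBOW
`ω ⊆ E`; an arrow assignment `s` invariant under `σ = nextCorner (cfgOf ω)` at the non-cut corners
over the piece `CS = cornerSet M.piece` and equal to `bit h₀` at the cuts; `ω₀` the own
configuration of `h₀` (equal-endpoint live edges; rainbow, all live turns consistent:
`S17RainbowOfConfig`), `σ₀ = nextCorner (cfgOf ω₀)`, `w c = sgn (s c) - sgn (bit h₀ c)`.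
* `he_sum_next` — `σ` is a bijection of `CS` (`nextCorner_cfgOf_mem_cornerSet_iff`; reindexing of sums);
* `he_tracked_of_not_isCut`, `he_bit_next_eq` — non-cuts are tracked with tracked successors, and
  `bit h₀` is `σ₀`-invariant there (Lemmas C and V);
* `he_start_end`, **`he_compat`** — a non-cut successor `o` of a cut is a registered end `(o, m)`
  (first cut along any rainbow `ω'`, its partner, injectivity of the turning rule), and
  `s o = bit h₀ o`: `s` is constant along the `ω`-strand from `o`, `bit h₀` along the `ω₀`-strand,
  both finish at the other end with tag `m`, a cut, where `s = bit h₀`;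
* `he_w_cut`, `he_w_next_cut`, `he_transfer`, `he_end_good` — `w` vanishes at and after cuts and at
  registered ends, and is invariant under the frozen turning rule;
* **`he_div`** (registered `s17_heightsExist_part2`) — the CYCLE CONDITION
  `∑_{c ∈ CS} w(c) (g(head c) - g(tail c)) = 0`: reindex the `s`-part by `σ`, the `bit h₀`-part by
  `σ₀`; the defects sit at the cuts `c`, where `w c = w (σ_∅ c) = 0`. Input of Part 1's toolkit.
-/

namespace Summit.CriticalPhenomena.CardyFormulaZ2.Cruxes.BoundaryDefectGaussianR.RainbowMonomialsInExcursionKernels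

open Finset Literature.Probability.LatticeModels Literature.Probability.LatticeModels.CollarLegModel
open Literature.Probability.Percolation Literature.Probability.LatticeModels.MedialTrail

/-! ### The turning rule on the corners over the piece -/

section Piece

variable (M : CollarLegModel)

/-- **Reindexing by the turning rule**: `σ = nextCorner (cfgOf ω)` (`ω ⊆ E`) is a bijection of the
finite set of corners over the piece. [folklore] -/
theorem he_sum_next {ω : Finset ((ℤ × ℤ) × Bool)} (hω : ω ⊆ M.E) (F : Site 2 × Fin 4 → ℤ) :
    ∑ c ∈ cornerSet M.piece, F (nextCorner (M.cfgOf ω) c) = ∑ c ∈ cornerSet M.piece, F c := by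
  have hinj : ∀ x ∈ cornerSet M.piece, ∀ y ∈ cornerSet M.piece, nextCorner (M.cfgOf ω) x = nextCorner (M.cfgOf ω) y →
      x = y := fun x _ y _ h => nextCorner_injective h
  have himg : (cornerSet M.piece).image (nextCorner (M.cfgOf ω)) = cornerSet M.piece := by
    apply Finset.eq_of_subset_of_card_le _ (by rw [Finset.card_image_of_injOn hinj])
    intro x hx
    obtain ⟨c, hc, rfl⟩ := mem_image.1 hx
    exact (nextCorner_cfgOf_mem_cornerSet_iff M hω c).2 hc
  rw [← Finset.sum_image hinj, himg]

/-- **Non-cut corners are tracked, with tracked successors** in `cfgOf ω`, `ω ⊆ E` (live target: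
both at vertices of `V`; frozen: a consistent tracked turn of the prescribed data). [folklore] -/
theorem he_tracked_of_not_isCut {ω : Finset ((ℤ × ℤ) × Bool)} (hω : ω ⊆ M.E) {c : Site 2 × Fin 4}
    (hc : ¬M.IsCut c) : M.IsTracked c ∧ M.IsTracked (nextCorner (M.cfgOf ω) c) := by
  by_cases hl : M.TargetsLive c
  · exact perCfg_isTracked_of_targetsLive M _ hl
  · have htc : M.TurnConsistent (fun _ => 0) (M.cfgOf ∅) c := by
      by_contra h; exact hc ⟨hl, h⟩
    exact ⟨htc.1, by rw [nextCorner_cfgOf_eq_of_not_targetsLive hω hl]; exact htc.2.1⟩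

end Piece

/-! ### The model of an admissible flat charted insertion -/

section Model

variable (ι : LegInsertionData) (V : Finset (ℤ × ℤ)) (hadm : ι.IsAdmissible V)
  (hflat : ∀ x ∈ insert ι.sink ι.source, ∃ dvec : ℤ × ℤ,
    (dvec = (1, 0) ∨ dvec = (-1, 0) ∨ dvec = (0, 1) ∨ dvec = (0, -1)) ∧
    ∀ v : ℤ × ℤ, (v.1 - x.1) ^ 2 + (v.2 - x.2) ^ 2 ≤ ((ι.sinkLegs : ℤ) + 4) ^ 2 →
      (v ∈ V ↔ 0 ≤ (v.1 - x.1) * dvec.1 + (v.2 - x.2) * dvec.2))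
  (hchart : ∀ u ∈ V, ∀ k : Fin 4, u + dir k ∉ V → ∃ (K : Fin 4) (c₁ c₂ : ℤ),
    (∀ v : ℤ × ℤ, |v.1 - u.1| ≤ 3 → |v.2 - u.2| ≤ 3 →
      (v ∈ V ↔ c₂ ≤ v.1 * (dir (K + 1)).1 + v.2 * (dir (K + 1)).2)) ∨
    (∀ v : ℤ × ℤ, |v.1 - u.1| ≤ 3 → |v.2 - u.2| ≤ 3 →
      (v ∈ V ↔ c₁ ≤ v.1 * (dir K).1 + v.2 * (dir K).2 ∧
        c₂ ≤ v.1 * (dir (K + 1)).1 + v.2 * (dir (K + 1)).2)) ∨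
    (∀ v : ℤ × ℤ, |v.1 - u.1| ≤ 3 → |v.2 - u.2| ≤ 3 →
      (v ∈ V ↔ c₂ ≤ v.1 * (dir (K + 1)).1 + v.2 * (dir (K + 1)).2 ∨
        v.1 * (dir K).1 + v.2 * (dir K).2 ≤ c₁)))

include hadm hflat hchart in
/-- **`bit h₀` is invariant under the turning rule of the own configuration of `h₀` at every
non-cut corner** (live turns: Lemma V and the pairing; frozen non-cut turns: Lemma C). [cite: BaxterKellandWu1976, §4] -/
theorem he_bit_next_eq {h₀ : ↥(ι.model V).freeCells → ℤ} (hh₀ : h₀ ∈ (ι.model V).configs)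
    {c : Site 2 × Fin 4} (hc : ¬(ι.model V).IsCut c) :
    (ι.model V).bit h₀ (nextCorner ((ι.model V).cfgOf (((ι.model V).E).filter
      (fun e => (ι.model V).hv h₀ e.1 = (ι.model V).hv h₀ (SixVertex.edgeTip e)))) c) = (ι.model V).bit h₀ c := by
  have hval : (ι.model V).IsValid h₀ := (mem_configs_iff_isValid _ h₀).1 hh₀
  have hunitL := unitDifferences_live V ι hadm hflat (chart8_of_chart3 hchart) h₀ hval
  have hunitT := unitDifferences_tracked V ι hadm hflat (chart8_of_chart3 hchart) h₀ hval
  have htc : (ι.model V).TurnConsistent h₀ ((ι.model V).cfgOf (((ι.model V).E).filter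
      (fun e => (ι.model V).hv h₀ e.1 = (ι.model V).hv h₀ (SixVertex.edgeTip e)))) c := by
    by_cases hl : (ι.model V).TargetsLive c
    · exact turnConsistent_of_targetsLive_pairing (ι.model V) h₀ hunitL c hl
    · have htc0 : (ι.model V).TurnConsistent (fun _ => 0) ((ι.model V).cfgOf ∅) c := by
        by_contra h; exact hc ⟨hl, h⟩
      exact frozen_transfer ι V hadm (tc_noPinch_of_chart hchart) (filter_subset _ _) h₀ c hl htc0
  exact perCfg_bit_eq_of_turnConsistent hunitT htc

include hadm hflat hchart in
/-- **A non-cut successor `o` of a cut is a registered strand end**, tagged like the first cut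
`b = σ'^n o` met along any RAINBOW `ω' ⊆ E` (`b` is a tracked cut, hence a registered end `(b, m)`,
Part 38; its partner is joined to `b`, follows a cut, Part 27, and two cut-free runs into `b`
starting right after a cut coincide). [cite: BaxterKellandWu1976, §3–§4] -/
theorem he_start_end {ω' : Finset ((ℤ × ℤ) × Bool)} (hω' : ω' ⊆ (ι.model V).E) (hR : ι.Rainbow V ω')
    {c₀ o : Site 2 × Fin 4} (hc₀ : (ι.model V).IsCut c₀) (ho : nextCorner ((ι.model V).cfgOf ∅) c₀ = o)
    (hocut : ¬(ι.model V).IsCut o) :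
    ∃ (n : ℕ) (m : ℤ), 1 ≤ n ∧ (ι.model V).IsCut ((nextCorner ((ι.model V).cfgOf ω'))^[n] o) ∧
      (∀ k < n, ¬(ι.model V).IsCut ((nextCorner ((ι.model V).cfgOf ω'))^[k] o)) ∧
      (((nextCorner ((ι.model V).cfgOf ω'))^[n] o, m) ∈ ι.strandEnds V) ∧ ((o, m) ∈ ι.strandEnds V) := by
  classical
  have hflat3 := flat3_of_flat4 ι V hflat
  set σ := nextCorner ((ι.model V).cfgOf ω') with hσ
  have hpe' : σ c₀ = o := by rw [hσ, nextCorner_cfgOf_eq_of_not_targetsLive hω' hc₀.1, ho]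
  have htr_of : ∀ c, ¬(ι.model V).IsCut c → (ι.model V).IsTracked c ∧ (ι.model V).IsTracked (σ c) :=
    fun c hc => he_tracked_of_not_isCut (ι.model V) hω' hc
  have hex : ∃ n, n ≤ 4 * (ι.model V).vertexCells.card ∧ (ι.model V).IsCut (σ^[n] o) := by
    by_contra hno
    push Not at hno
    have htr : ∀ m ≤ 4 * (ι.model V).vertexCells.card + 1, (ι.model V).IsTracked (σ^[m] o) := by
      intro m hm
      rcases m with _ | k
      · exact (htr_of o hocut).1
      · rw [Function.iterate_succ_apply']
        exact (htr_of _ (hno k (by omega))).2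
    obtain ⟨i, j, hij, hj, hEq⟩ := exists_lt_iterate_eq htr (Nat.le_succ _)
    have hper := iterate_sub_eq_self hij hEq
    have hpred := iterate_pred_eq (Nat.le_sub_of_add_le' hij) hper hpe'
    exact hno (j - i - 1) (by omega) (by rw [hpred]; exact hc₀)
  set n := Nat.find hex with hn
  have hncut : (ι.model V).IsCut (σ^[n] o) := (Nat.find_spec hex).2
  have hnN : n ≤ 4 * (ι.model V).vertexCells.card := (Nat.find_spec hex).1
  have hbefore : ∀ k < n, ¬(ι.model V).IsCut (σ^[k] o) := fun k hk hc =>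
    absurd (Nat.find_min' hex ⟨(le_of_lt hk).trans hnN, hc⟩) (not_le.2 hk)
  have hn1 : 1 ≤ n := by by_contra h0; rw [show n = 0 by omega] at hncut; exact hocut hncut
  have htrb : (ι.model V).IsTracked (σ^[n] o) := by
    obtain ⟨k, hk⟩ : ∃ k, n = k + 1 := ⟨n - 1, by omega⟩
    rw [hk, Function.iterate_succ_apply']
    exact (htr_of _ (hbefore k (by omega))).2
  obtain ⟨m, hm⟩ := tc_trackedCuts_are_ends ι V hadm hflat3 hchart _ htrb hncut
  obtain ⟨hrange, htwo, hinj, -⟩ := s14_strandEnds_tags ι V hadm hflat3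
  obtain ⟨x, y, hxy, hS⟩ := Finset.card_eq_two.1 (htwo m (hrange _ hm).1 (hrange _ hm).2)
  have hbm : (σ^[n] o, m) ∈ (ι.strandEnds V).filter (fun e => e.2 = m) := mem_filter.2 ⟨hm, rfl⟩
  obtain ⟨e', he'S, hne'⟩ : ∃ e' ∈ (ι.strandEnds V).filter (fun e => e.2 = m), e' ≠ (σ^[n] o, m) := by
    rw [hS] at hbm ⊢
    rcases mem_insert.1 hbm with h | h
    · exact ⟨y, mem_insert_of_mem (mem_singleton_self y), fun h' => hxy (h'.trans h).symm⟩
    · exact ⟨x, mem_insert_self x _, fun h' => hxy (h'.trans (mem_singleton.1 h))⟩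
  have he' : e' ∈ ι.strandEnds V := (mem_filter.1 he'S).1
  have htag : e'.2 = m := (mem_filter.1 he'S).2
  have hne1 : e'.1 ≠ σ^[n] o := fun h => hne' (hinj e' he' _ hm h)
  rcases hR (σ^[n] o, m) hm e' he' htag.symm hne1.symm with hJ | hJ
  · obtain ⟨n', -, hEq, hnc⟩ := hJ
    rcases Nat.eq_zero_or_pos n' with h0 | hpos
    · rw [h0] at hEq; exact absurd hEq.symm hne1
    · exact absurd hncut (hnc 0 hpos)
  · obtain ⟨n', -, hEq, hnc⟩ := hJ
    change σ^[n'] e'.1 = σ^[n] o at hEq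
    have he'cut : ¬(ι.model V).IsCut e'.1 := by
      intro hc
      rcases Nat.eq_zero_or_pos n' with h0 | hpos
      · rw [h0] at hEq; exact hne1 hEq
      · exact hnc 0 hpos hc
    obtain ⟨c₀', hc₀', hpe⟩ := s14_strandEnds_start ι V hadm hflat3 e' he' he'cut
    have hpe2 : σ c₀' = e'.1 := by rw [hσ, nextCorner_cfgOf_eq_of_not_targetsLive hω' hc₀'.1, hpe]
    have key : o = e'.1 := by
      rcases le_or_gt n n' with hle | hlt
      · have h1 : σ^[n] o = σ^[n] (σ^[n' - n] e'.1) := by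
          rw [← Function.iterate_add_apply, Nat.add_sub_cancel' hle, hEq]
        have h2 : o = σ^[n' - n] e'.1 := (nextCorner_injective.iterate n) h1
        rcases Nat.eq_zero_or_pos (n' - n) with h0 | hpos
        · rw [h0] at h2; exact h2
        · obtain ⟨k, hk⟩ : ∃ k, n' - n = k + 1 := ⟨n' - n - 1, by omega⟩
          rw [hk, Function.iterate_succ_apply'] at h2
          have h4 := nextCorner_injective (h2.symm.trans hpe'.symm)
          exact absurd (h4 ▸ hc₀) (hnc k (by omega))
      · exfalso
        have h1 : σ^[n'] e'.1 = σ^[n'] (σ^[n - n'] o) := by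
          rw [← Function.iterate_add_apply, Nat.add_sub_cancel' hlt.le, hEq]
        have h2 : e'.1 = σ^[n - n'] o := (nextCorner_injective.iterate n') h1
        obtain ⟨k, hk⟩ : ∃ k, n - n' = k + 1 := ⟨n - n' - 1, by omega⟩
        rw [hk, Function.iterate_succ_apply'] at h2
        have h4 := nextCorner_injective (h2.symm.trans hpe2.symm)
        exact hbefore k (by omega) (by rw [h4]; exact hc₀')
    exact ⟨n, m, hn1, hncut, hbefore, hm, by rw [← show e' = (o, m) from Prod.ext key.symm htag]; exact he'⟩

variable {h₀ : ↥(ι.model V).freeCells → ℤ} (hh₀ : h₀ ∈ (ι.model V).configs)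
  {ω : Finset ((ℤ × ℤ) × Bool)} (hω : ω ⊆ (ι.model V).E) (hR : ι.Rainbow V ω)
  {s : Site 2 × Fin 4 → Bool}
  (hs1 : ∀ c ∈ cornerSet (ι.model V).piece, ¬(ι.model V).IsCut c → s (nextCorner ((ι.model V).cfgOf ω) c) = s c)
  (hs2 : ∀ c ∈ cornerSet (ι.model V).piece, (ι.model V).IsCut c → s c = (ι.model V).bit h₀ c)

include hadm hflat hchart hh₀ hω hR hs1 hs2 in
/-- **Compatibility of the arrows at the starts**: at a non-cut corner `o` following a cut,
`s o = bit h₀ o` — the `ω`-strand and the `ω₀`-strand from the registered end `(o, m)` both finish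
at the other end `b` with tag `m`, a cut, and `s` resp. `bit h₀` are constant along them. [cite: BaxterKellandWu1976, §3–§4] -/
theorem he_compat {c₀ o : Site 2 × Fin 4} (hc₀ : (ι.model V).IsCut c₀)
    (ho : nextCorner ((ι.model V).cfgOf ∅) c₀ = o) (hocut : ¬(ι.model V).IsCut o) :
    s o = (ι.model V).bit h₀ o := by
  classical
  have hflat3 := flat3_of_flat4 ι V hflat
  set ω₀ := ((ι.model V).E).filter (fun e => (ι.model V).hv h₀ e.1 = (ι.model V).hv h₀ (SixVertex.edgeTip e)) with hω₀
  have hω₀E : ω₀ ⊆ (ι.model V).E := filter_subset _ _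
  have hR₀ : ι.Rainbow V ω₀ := rainbow_of_config ι V hadm hflat hchart h₀ hh₀
  obtain ⟨n, m, hn1, hcb, hbefore, hbm, hom⟩ := he_start_end ι V hadm hflat hchart hω hR hc₀ ho hocut
  obtain ⟨n₀, m₀, -, hcb₀, hbefore₀, hb₀m, hom₀⟩ := he_start_end ι V hadm hflat hchart hω₀E hR₀ hc₀ ho hocut
  obtain ⟨hrange, htwo, hinj, -⟩ := s14_strandEnds_tags ι V hadm hflat3
  have hmm : m₀ = m := by simpa only [Prod.mk.injEq, true_and] using hinj _ hom₀ _ hom rfl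
  rw [hmm] at hb₀m
  set σ := nextCorner ((ι.model V).cfgOf ω) with hσ
  set σ₀ := nextCorner ((ι.model V).cfgOf ω₀) with hσ₀
  have hbb : σ^[n] o = σ₀^[n₀] o := by
    have h3 := atMostTwo_of_tags hrange htwo _ hom _ hbm _ hb₀m rfl rfl
    simp only at h3
    rcases h3 with h | h | h
    · rw [← h] at hcb; exact absurd hcb hocut
    · rw [← h] at hcb₀; exact absurd hcb₀ hocut
    · exact h
  -- `s` is constant along the `ω`-strand, `bit h₀` along the `ω₀`-strand
  have hs_const : ∀ k ≤ n, s (σ^[k] o) = s o := by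
    intro k
    induction k with
    | zero => intro; rfl
    | succ k ih =>
      intro hk
      have hnc := hbefore k (Nat.lt_of_succ_le hk)
      rw [Function.iterate_succ_apply', hs1 _ (mem_cornerSet_of_isTracked
        (he_tracked_of_not_isCut (ι.model V) hω hnc).1) hnc]
      exact ih (Nat.lt_of_succ_le hk).le
  have hb_const : ∀ k ≤ n₀, (ι.model V).bit h₀ (σ₀^[k] o) = (ι.model V).bit h₀ o := by
    intro k
    induction k with
    | zero => intro; rfl
    | succ k ih =>
      intro hk
      rw [Function.iterate_succ_apply', hσ₀, hω₀, he_bit_next_eq ι V hadm hflat hchart hh₀ (hbefore₀ k (Nat.lt_of_succ_le hk))]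
      exact ih (Nat.lt_of_succ_le hk).le
  have htrb : (ι.model V).IsTracked (σ^[n] o) := by
    obtain ⟨k, hk⟩ : ∃ k, n = k + 1 := ⟨n - 1, by omega⟩
    rw [hk, Function.iterate_succ_apply']
    exact (he_tracked_of_not_isCut (ι.model V) hω (hbefore k (by omega))).2
  calc s o = s (σ^[n] o) := (hs_const n le_rfl).symm
    _ = (ι.model V).bit h₀ (σ^[n] o) := hs2 _ (mem_cornerSet_of_isTracked htrb) hcb
    _ = (ι.model V).bit h₀ (σ₀^[n₀] o) := by rw [hbb]
    _ = (ι.model V).bit h₀ o := hb_const n₀ le_rfl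

include hs2 in
/-- `w = sgn s - sgn (bit h₀)` vanishes at the cuts over the piece. [folklore] -/
theorem he_w_cut {c : Site 2 × Fin 4} (hc : c ∈ cornerSet (ι.model V).piece) (hcut : (ι.model V).IsCut c) :
    BKW.sgn (s c) - BKW.sgn ((ι.model V).bit h₀ c) = 0 := by
  rw [hs2 c hc hcut, sub_self]

include hadm hflat hchart hh₀ hω hR hs1 hs2 in
/-- `w` vanishes right after a cut (a cut or a start). [folklore] -/
theorem he_w_next_cut {c : Site 2 × Fin 4} (hc : c ∈ cornerSet (ι.model V).piece) (hcut : (ι.model V).IsCut c) :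
    BKW.sgn (s (nextCorner ((ι.model V).cfgOf ∅) c)) -
      BKW.sgn ((ι.model V).bit h₀ (nextCorner ((ι.model V).cfgOf ∅) c)) = 0 := by
  by_cases hcut' : (ι.model V).IsCut (nextCorner ((ι.model V).cfgOf ∅) c)
  · exact he_w_cut ι V hs2 ((nextCorner_cfgOf_mem_cornerSet_iff (ι.model V) (empty_subset _) c).2 hc) hcut'
  · rw [he_compat ι V hadm hflat hchart hh₀ hω hR hs1 hs2 hcut rfl hcut', sub_self]

include hadm hflat hchart hh₀ hω hR hs1 hs2 in
/-- **`w` is invariant under the frozen turning rule**: for a corner over the piece with frozen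
target, `w (σ_∅ c) = w c` (non-cut: both `s` and `bit h₀` are invariant; cut: both sides vanish). [folklore] -/
theorem he_transfer {c : Site 2 × Fin 4} (hc : c ∈ cornerSet (ι.model V).piece) (hl : ¬(ι.model V).TargetsLive c) :
    BKW.sgn (s (nextCorner ((ι.model V).cfgOf ∅) c)) - BKW.sgn ((ι.model V).bit h₀ (nextCorner ((ι.model V).cfgOf ∅) c)) =
      BKW.sgn (s c) - BKW.sgn ((ι.model V).bit h₀ c) := by
  by_cases hcut : (ι.model V).IsCut c
  · rw [he_w_next_cut ι V hadm hflat hchart hh₀ hω hR hs1 hs2 hc hcut, he_w_cut ι V hs2 hc hcut]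
  · have e1 : nextCorner ((ι.model V).cfgOf ω) c = nextCorner ((ι.model V).cfgOf ∅) c :=
      nextCorner_cfgOf_eq_of_not_targetsLive hω hl
    have e2 := nextCorner_cfgOf_eq_of_not_targetsLive (M := ι.model V) (ω := ((ι.model V).E).filter
      (fun e => (ι.model V).hv h₀ e.1 = (ι.model V).hv h₀ (SixVertex.edgeTip e))) (filter_subset _ _) hl
    have h1 := hs1 c hc hcut
    have h2 := he_bit_next_eq ι V hadm hflat hchart hh₀ hcut
    rw [e1] at h1; rw [e2] at h2; rw [h1, h2]

include hadm hflat hchart hh₀ hω hR hs1 hs2 in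
/-- **`w` vanishes at every registered strand end** (a cut, or a start after a cut). [folklore] -/
theorem he_end_good {e : (Site 2 × Fin 4) × ℤ} (he : e ∈ ι.strandEnds V) :
    BKW.sgn (s e.1) - BKW.sgn ((ι.model V).bit h₀ e.1) = 0 := by
  have hflat3 := flat3_of_flat4 ι V hflat
  have htr : (ι.model V).IsTracked e.1 := (s14_strandEnds_pairs ι V hadm hflat3 e he).1
  by_cases hcut : (ι.model V).IsCut e.1
  · exact he_w_cut ι V hs2 (mem_cornerSet_of_isTracked htr) hcut
  · obtain ⟨c₀, hc₀, hpe⟩ := s14_strandEnds_start ι V hadm hflat3 e he hcut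
    rw [he_compat ι V hadm hflat hchart hh₀ hω hR hs1 hs2 hc₀ hpe hcut, sub_self]

include hadm hflat hchart hh₀ hω hR hs1 hs2 in
/-- **The cycle condition of `w = sgn s - sgn (bit h₀)`** on the corners over the piece:
`∑_{c ∈ CS} w(c) (g(head c) - g(tail c)) = 0` for every `g` (reindex the `s`-part by `σ`, the
`bit h₀`-part by `σ₀`; the defects sit at the cuts `c`, where `w c = w (σ_∅ c) = 0`). [cite: BaxterKellandWu1976, §3] -/
theorem he_div (g : ℤ × ℤ → ℤ) :
    ∑ c ∈ cornerSet (ι.model V).piece, (BKW.sgn (s c) - BKW.sgn ((ι.model V).bit h₀ c)) *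
      (g (cornerDart c).2 - g (cornerDart c).1) = 0 := by
  classical
  set ω₀ := ((ι.model V).E).filter (fun e => (ι.model V).hv h₀ e.1 = (ι.model V).hv h₀ (SixVertex.edgeTip e)) with hω₀
  have hω₀E : ω₀ ⊆ (ι.model V).E := filter_subset _ _
  set σ := nextCorner ((ι.model V).cfgOf ω) with hσ
  set σ₀ := nextCorner ((ι.model V).cfgOf ω₀) with hσ₀
  -- the defect terms vanish
  have hT : ∀ c ∈ cornerSet (ι.model V).piece,
      (BKW.sgn (s c) - BKW.sgn (s (σ c))) * g (cpos (σ c)) -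
        (BKW.sgn ((ι.model V).bit h₀ c) - BKW.sgn ((ι.model V).bit h₀ (σ₀ c))) * g (cpos (σ₀ c)) = 0 := by
    intro c hc
    by_cases hcut : (ι.model V).IsCut c
    · have e1 : σ c = nextCorner ((ι.model V).cfgOf ∅) c := nextCorner_cfgOf_eq_of_not_targetsLive hω hcut.1
      have e2 : σ₀ c = nextCorner ((ι.model V).cfgOf ∅) c := nextCorner_cfgOf_eq_of_not_targetsLive hω₀E hcut.1
      have w0 := he_w_cut ι V hs2 hc hcut
      have w1 := he_w_next_cut ι V hadm hflat hchart hh₀ hω hR hs1 hs2 hc hcut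
      rw [e1, e2]
      linear_combination (g (cpos (nextCorner ((ι.model V).cfgOf ∅) c))) * w0 -
        (g (cpos (nextCorner ((ι.model V).cfgOf ∅) c))) * w1
    · rw [hs1 c hc hcut, hσ₀, hω₀, he_bit_next_eq ι V hadm hflat hchart hh₀ hcut]; ring
  have hTsum := Finset.sum_eq_zero hT
  simp only [sub_mul, Finset.sum_sub_distrib] at hTsum
  have rs := he_sum_next (ι.model V) hω (fun c => BKW.sgn (s c) * g (cpos c))
  have rb := he_sum_next (ι.model V) hω₀E (fun c => BKW.sgn ((ι.model V).bit h₀ c) * g (cpos c))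
  rw [← hσ] at rs; rw [← hσ₀] at rb
  have hterm : ∀ c ∈ cornerSet (ι.model V).piece,
      (BKW.sgn (s c) - BKW.sgn ((ι.model V).bit h₀ c)) * (g (cornerDart c).2 - g (cornerDart c).1) =
        (BKW.sgn (s c) * g (cpos (σ c)) - BKW.sgn ((ι.model V).bit h₀ c) * g (cpos (σ₀ c))) -
          (BKW.sgn (s c) * g (cpos c) - BKW.sgn ((ι.model V).bit h₀ c) * g (cpos c)) := by
    intro c _
    have h1 : BKW.sgn (s c) * g (cornerDart c).2 = BKW.sgn (s c) * g (cpos (σ c)) := by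
      rw [cornerDart_eq ((ι.model V).cfgOf ω) c]
    have h2 : BKW.sgn ((ι.model V).bit h₀ c) * g (cornerDart c).2 =
        BKW.sgn ((ι.model V).bit h₀ c) * g (cpos (σ₀ c)) := by rw [cornerDart_eq ((ι.model V).cfgOf ω₀) c]
    rw [show (cornerDart c).1 = cpos c from rfl]
    linear_combination h1 - h2
  rw [Finset.sum_congr rfl hterm, Finset.sum_sub_distrib, Finset.sum_sub_distrib, Finset.sum_sub_distrib]
  linear_combination hTsum + rs - rb

end Model

/-- **Sub-goal `s17_heightsExist_part2`** (registered on stmt-CriticalPhenomena-14132; T5c, Part 2):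
for an ADMISSIBLE insertion with FLAT points (radius `sinkLegs + 4`) and radius-`3` CHARTS, a valid
`h₀`, a RAINBOW `ω ⊆ E` and an arrow assignment `s` invariant under the turning rule of `cfgOf ω`
off the cuts over the piece and equal to `bit h₀` at the cuts, `w = sgn s - sgn (bit h₀)` satisfies
the CYCLE CONDITION `∑_c w(c) (g(head c) - g(tail c)) = 0`. [cite: BaxterKellandWu1976, §3–§4] -/
theorem s17_heightsExist_part2 : ∀ (ι : Literature.Probability.LatticeModels.CollarLegModel.LegInsertionData) (V : Finset (ℤ × ℤ)), ι.IsAdmissible V → (∀ x ∈ insert ι.sink ι.source, ∃ dvec : ℤ × ℤ, (dvec = (1, 0) ∨ dvec = (-1, 0) ∨ dvec = (0, 1) ∨ dvec = (0, -1)) ∧ ∀ v : ℤ × ℤ, (v.1 - x.1) ^ 2 + (v.2 - x.2) ^ 2 ≤ ((ι.sinkLegs : ℤ) + 4) ^ 2 → (v ∈ V ↔ 0 ≤ (v.1 - x.1) * dvec.1 + (v.2 - x.2) * dvec.2)) → (∀ u ∈ V, ∀ k : Fin 4, u + Literature.Probability.LatticeModels.CollarLegModel.dir k ∉ V → ∃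 (K : Fin 4) (c₁ c₂ : ℤ), (∀ v : ℤ × ℤ, |v.1 - u.1| ≤ 3 → |v.2 - u.2| ≤ 3 → (v ∈ V ↔ c₂ ≤ v.1 * (Literature.Probability.LatticeModels.CollarLegModel.dir (K + 1)).1 + v.2 * (Literature.Probability.LatticeModels.CollarLegModel.dir (K + 1)).2)) ∨ (∀ v : ℤ × ℤ, |v.1 - u.1| ≤ 3 → |v.2 - u.2| ≤ 3 → (v ∈ V ↔ c₁ ≤ v.1 * (Literature.Probability.LatticeModels.CollarLegModel.dir K).1 + v.2 * (Literature.Probability.LatticeModels.CollarLegModel.dir K).2 ∧ c₂ ≤ v.1 * (Literature.Probability.LatticeModels.CollarLegModel.dir (K + 1)).1 + v.2 * (Literature.Probability.LatticeModels.CollarLegModel.dir (K + 1)).2)) ∨ (∀ v : ℤ × ℤ, |v.1 - u.1| ≤ 3 → |v.2 - u.2| ≤ 3 → (v ∈ V ↔ c₂ ≤ v.1 * (Literature.Probability.LatticeModels.CollarLegModel.dir (K + 1)).1 + v.2 * (Literature.Probability.LatticeModels.CollarLegModel.dir (K + 1)).2 ∨ v.1 * (Literature.Probability.LatticeModels.CollarLegModel.dir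 K).1 + v.2 * (Literature.Probability.LatticeModels.CollarLegModel.dir K).2 ≤ c₁))) → ∀ (h₀ : ↥(ι.model V).freeCells → ℤ), h₀ ∈ (ι.model V).configs → ∀ (ω : Finset ((ℤ × ℤ) × Bool)), ω ⊆ (ι.model V).E → ι.Rainbow V ω → ∀ (s : Literature.Probability.LatticeModels.Site 2 × Fin 4 → Bool), (∀ c ∈ Literature.Probability.Percolation.cornerSet (ι.model V).piece, ¬(ι.model V).IsCut c → s (Literature.Probability.LatticeModels.nextCorner ((ι.model V).cfgOf ω) c) = s c) → (∀ c ∈ Literature.Probability.Percolation.cornerSet (ι.model V).piece, (ι.model V).IsCut c → s c = (ι.model V).bit h₀ c) → ∀ g : ℤ × ℤ → ℤ, ∑ c ∈ Literature.Probability.Percolation.cornerSet (ι.model V).piece, (Literature.Probability.Percolation.BKW.sgn (s c) - Literature.Probability.Percolation.BKW.sgn ((ι.model V).bit h₀ c)) * (g (Literature.Probability.Percolation.cornerDart c).2 - g (Literature.Probability.Percolation.cornerDart c).1) = 0 :=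
  fun ι V hadm hflat hchart _ hh₀ _ hω hR _ hs1 hs2 g => he_div ι V hadm hflat hchart hh₀ hω hR hs1 hs2 g

end Summit.CriticalPhenomena.CardyFormulaZ2.Cruxes.BoundaryDefectGaussianR.RainbowMonomialsInExcursionKernels
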